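import Literature.NumberTheory.LFunctions.Zhang2022.DetectorConeClosure

/-!
# Zhang (2022), programme F-S3 (cell landau-siegel, §E E-102 head 1): the ANCHOR MOMENT KERNEL
# `(x, y) ↦ Re m₀(a; x, y) = Re Det.ddM0 ![a, x, y]` is POSITIVE-SEMIDEFINITE on the whole real line for `a ∈ (0, 2)`
# (desk conjecture L-B′1 of the cell, here a theorem), via an explicit Volterra / ground-state Gram representation

Y. Zhang, *Discrete mean estimates and the Landau–Siegel zero*, arXiv:2211.02515v1 [Zhang2022LandauSiegel] — an
unrefereed manuscript under adjudication. **WHAT THIS IS NOT: not a claim about Theorems 1–2 of arXiv:2211.02515, about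
Landau–Siegel zeros, or about Parity; nothing here asserts any claim of the manuscript or the open row E-102.** It proves an
unconditional real-analysis fact about the first confluent divided-difference moment `m₀ = Det.ddM0` of the tree
(`DetectorShiftMomentsDD`): the cell's desk conjecture **L-B′1** (ls-Bdet-typer-1, E102-LINEB-PARSEVAL-NOTE §3; ls-theory
ruling 2026-08-27T01:28:47Z: «necessary for head 1 of E-102, sufficient on the apex-and-mean-vanishing sub-class»).
«The programme SEARCHES and TYPES; no claim about Landau–Siegel zeros, Theorems 1–2 of arXiv:2211.02515 or a repaired
Margin232 until a kernel theorem says so.»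

**The mathematics (four lines).** Write `θ = πa/2`, `α = π(x−a)`, `β = π(y−a)`. Leibniz + Hermite–Genocchi give
`m₀(a;x,y) = e^{iπB}·(t e^{−iπt})[a,x,y] = −iπ·e^{iθ}·( ∫_{−½}^{½} (G_x′ Ḡ_y′ − θ² G_x Ḡ_y) ds − iθ·G_x(½) Ḡ_y(½) )` with the
ONE-parameter family of primitives `G_x(s) := e^{iθs} ∫_{−½}^{s} e^{iαt} dt` (`Det.anchorG`; `G_x(−½) = 0`) — an identity of
exponential sums, proved here at all nodes `x, y ≠ a` (generic nodes by the three-term residue formula `Det.dd2_of_ne`,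
the confluent diagonal `y = x` by the tree's confluent branch). Summing against real coefficients `p_j` and taking real parts,
`Σ_{j,l} p_j p_l Re m₀(a;x_j,x_l) = π·( sin θ·∫_{−½}^{½}(‖𝒢′‖² − θ²‖𝒢‖²) − θ cos θ·‖𝒢(½)‖² )`, `𝒢 := Σ_j p_j G_{x_j}`, and the
bracket is `≥ 0` for `θ ∈ (0, π)` by the GROUND-STATE (Picone) identity with `φ(s) = sin(θ(s+½+δ))`, `δ ↓ 0`:
`‖𝒢′‖² − θ²‖𝒢‖² − (θ cot(θ(s+½+δ))·‖𝒢‖²)′ = ‖𝒢′ − θ cot(θ(s+½+δ))·𝒢‖² ≥ 0`. Nodes equal to the anchor (`x_j = a`) follow by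
continuity of `ddM0` (`Det.continuous_ddM0`, file `DetectorConeClosure`). Equivalently (not typed here): the kernel is
`Re⟨ε_{x−a}, H_a ε_{y−a}⟩` for the operator `H_a = π sin θ·I − (aπ²/2)(e^{−iθ}V + e^{iθ}V*)` on `L²(−½,½)` (`V` = Volterra
integration), `H_a ⪰ 0` with `ker H_a = ℂ·e^{−iπas}` — the kernel degenerates exactly along `x = 0` (`Re m₀(a;0,·) ≡ 0`).

* Part 1 — `Det.anchorTheta`, `Det.anchorG`, `Det.anchorG'` (closed forms), derivative and boundary value, the pointwise
  product identity `G_x′Ḡ_y′ − θ²G_xḠ_y = (1 + θ/α + θ/β)e^{i(α−β)s} − (θ/α)e^{−iα/2}e^{−iβs} − (θ/β)e^{iβ/2}e^{iαs}`.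
* Part 2 — the moment identity `Det.ddM0_eq_anchorPair` (`x, y ≠ a`; generic and confluent nodes).
* Part 3 — the ground-state inequality `Det.groundState_ineq` (any `C¹` path `f : ℝ → ℂ` with `f(−½) = 0`, `θ ∈ (0,π)`):
  `θ cos θ·‖f(½)‖² ≤ sin θ·∫_{−½}^{½} (‖f′‖² − θ²‖f‖²)`.
* Part 4 — **`Det.re_ddM0_sum_nonneg`**: for `a ∈ (0,2)`, every `n`, all `x p : Fin n → ℝ`,
  `0 ≤ Σ_j Σ_l p_j p_l · Re ddM0 ![a, x_j, x_l]` — L-B′1 on the whole line (anchor range `(0,1]` included).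

0 named facts, 0 sorries. Evidence trail (not load-bearing): cell kit j264893 (certified diagonal / 2×2 minors, lineage B),
ls-Bdet-typer-1 kits j263946/j264169 (float spectra). The consumer is the sub-class Gram form T-B′ of E102-LINEB-PARSEVAL-NOTE §2.

## References
* Y. Zhang, arXiv:2211.02515v1 (2022), Lemma 5.2 p.10, Prop 7.1 p.44 with (7.19)–(7.21). [cite: Zhang2022LandauSiegel, Prop 7.1 p.44]
* C. de Boor, *Divided differences*, Surveys in Approximation Theory 1 (2005) 46–69 (Leibniz rule, Hermite–Genocchi).
  [cite: deBoor2005DividedDifferences, §Continuity and smoothness]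
* Cell documents (not literature): E102-LINEB-PARSEVAL-NOTE.md f35b163d8bd1b367 §3 (L-B′1), E102-DISCHARGE.md v1.4b §8.3,
  ls-theory INBOX 2026-08-27T01:28:47Z (c)(d), ls-Bdet-num-2 INBOX 2026-08-27T01:55:15Z (this proof).
-/

noncomputable section

open Complex Real ComplexConjugate MeasureTheory intervalIntegral Filter Set
open scoped Topology RealInnerProductSpace

namespace Literature.NumberTheory.LFunctions.Zhang2022

namespace Det

/-! ### Part 1 — the anchor phase `θ = πa/2`, the frequencies `α = π(x−a)`, and the primitives `G_{a,x}` -/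

/-- The anchor phase `θ(a) = πa/2` (`e^{iθ}` is the phase `e^{iπB}` of `m₀` seen from the anchor). [folklore] -/
def anchorTheta (a : ℝ) : ℝ := π * a / 2

/-- The frequency of the node `x` seen from the anchor: `α(a,x) = π(x − a)`. [folklore] -/
def anchorFreq (a x : ℝ) : ℝ := π * (x - a)

/-- `α(a,x) ≠ 0` for `x ≠ a`. [folklore] -/
private theorem anchorFreq_ne_zero {a x : ℝ} (hx : x ≠ a) : (anchorFreq a x : ℂ) ≠ 0 := by
  unfold anchorFreq; exact_mod_cast mul_ne_zero pi_ne_zero (sub_ne_zero.mpr hx)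

/-- **The primitive `G_{a,x}(s) = e^{iθs}·(e^{iαs} − e^{−iα/2})/(iα)`** `= e^{iθs}·∫_{−½}^{s} e^{iαt}dt` (`α = π(x−a) ≠ 0`):
the phase-twisted Volterra primitive of the exponential `ε_{x−a}(s) = e^{iπ(x−a)s}` on `(−½, ½)`. [folklore] -/
def anchorG (a x s : ℝ) : ℂ :=
  cexp (I * anchorTheta a * s) *
    ((cexp (I * anchorFreq a x * s) - cexp (-(I * anchorFreq a x) / 2)) / (I * anchorFreq a x))

/-- Its `s`-derivative in closed form: `G′ = iθ·G + e^{i(θ+α)s}`. [folklore] -/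
def anchorG' (a x s : ℝ) : ℂ :=
  I * anchorTheta a * anchorG a x s + cexp (I * (anchorTheta a + anchorFreq a x) * s)

/-- `G_{a,x}(−½) = 0` (the Volterra primitive starts at the left end). [folklore] -/
private theorem anchorG_neg_half (a x : ℝ) : anchorG a x (-(1 / 2)) = 0 := by
  unfold anchorG
  have h : cexp (I * anchorFreq a x * ((-(1 / 2) : ℝ) : ℂ)) = cexp (-(I * anchorFreq a x) / 2) := by
    congr 1; push_cast; ring
  rw [h, sub_self, zero_div, mul_zero]

/-- `t ↦ e^{ct}` has derivative `c·e^{cs}` along the real line. [folklore] -/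
private theorem hasDerivAt_cexp_const_mul (c : ℂ) (s : ℝ) :
    HasDerivAt (fun t : ℝ => cexp (c * t)) (c * cexp (c * s)) s := by
  have h := (((hasDerivAt_id (s : ℂ)).const_mul c).cexp).comp_ofReal
  simp only [id_eq, mul_one] at h
  refine h.congr_deriv ?_
  ring

/-- `e^{i(θ+α)s} = e^{iθs}·e^{iαs}`. [folklore] -/
private theorem cexp_anchor_add (a x s : ℝ) :
    cexp (I * (anchorTheta a + anchorFreq a x) * s) = cexp (I * anchorTheta a * s) * cexp (I * anchorFreq a x * s) := by
  rw [← Complex.exp_add]; congr 1; ring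

/-- **`G′_{a,x}` is the derivative of `G_{a,x}`** (for `x ≠ a`). [folklore] -/
private theorem hasDerivAt_anchorG {a x : ℝ} (hx : x ≠ a) (s : ℝ) :
    HasDerivAt (fun t => anchorG a x t) (anchorG' a x s) s := by
  have hα := anchorFreq_ne_zero hx
  have hIα : (I * anchorFreq a x : ℂ) ≠ 0 := mul_ne_zero I_ne_zero hα
  have h1 := hasDerivAt_cexp_const_mul (I * anchorTheta a) s
  have h2 := ((hasDerivAt_cexp_const_mul (I * anchorFreq a x) s).sub_const
    (cexp (-(I * anchorFreq a x) / 2))).div_const (I * anchorFreq a x)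
  have h := h1.fun_mul h2
  have e1 : (fun t : ℝ => anchorG a x t) = fun t : ℝ => cexp (I * anchorTheta a * t) *
      ((cexp (I * anchorFreq a x * t) - cexp (-(I * anchorFreq a x) / 2)) / (I * anchorFreq a x)) := by
    funext t; rfl
  rw [e1]
  refine h.congr_deriv ?_
  rw [anchorG', anchorG, cexp_anchor_add]
  field_simp

/-- `t ↦ G_{a,x}(t)` is continuous. [folklore] -/
private theorem continuous_anchorG (a x : ℝ) : Continuous fun t => anchorG a x t := by
  unfold anchorG; fun_prop

/-- `t ↦ G′_{a,x}(t)` is continuous. [folklore] -/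
private theorem continuous_anchorG' (a x : ℝ) : Continuous fun t => anchorG' a x t := by
  unfold anchorG' anchorG; fun_prop

/-! ### Part 1b — conjugates in closed form and the pointwise product identity -/

/-- `conj e^{z} = (e^{z})⁻¹` for purely imaginary `z`. [folklore] -/
private theorem conj_cexp_eq_inv {z : ℂ} (hz : conj z = -z) : conj (cexp z) = (cexp z)⁻¹ := by
  rw [← Complex.exp_conj, hz, Complex.exp_neg]

/-- `conj e^{iθs} = (e^{iθs})⁻¹`. [folklore] -/
private theorem conj_cexp_I_mul_mul (r s : ℝ) : conj (cexp (I * r * s)) = (cexp (I * r * s))⁻¹ :=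
  conj_cexp_eq_inv (by simp only [map_mul, Complex.conj_I, Complex.conj_ofReal]; ring)

/-- `conj e^{−iα/2} = (e^{−iα/2})⁻¹`. [folklore] -/
private theorem conj_cexp_neg_I_mul_half (r : ℝ) : conj (cexp (-(I * r) / 2)) = (cexp (-(I * r) / 2))⁻¹ :=
  conj_cexp_eq_inv (by
    simp only [map_div₀, map_neg, map_mul, Complex.conj_I, Complex.conj_ofReal, map_ofNat]; ring)

/-- **`conj G_{a,y}(s)` in the same atoms:** `(e^{iθs})⁻¹·((e^{iβs})⁻¹ − (e^{−iβ/2})⁻¹)/(−iβ)`. [folklore] -/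
private theorem conj_anchorG (a y s : ℝ) : conj (anchorG a y s) =
    (cexp (I * anchorTheta a * s))⁻¹ *
      (((cexp (I * anchorFreq a y * s))⁻¹ - (cexp (-(I * anchorFreq a y) / 2))⁻¹) / (-(I * anchorFreq a y))) := by
  rw [anchorG, map_mul, map_div₀, map_sub, conj_cexp_I_mul_mul, conj_cexp_I_mul_mul, conj_cexp_neg_I_mul_half,
    map_mul, Complex.conj_I, Complex.conj_ofReal, neg_mul]

/-- **`conj G′_{a,y}(s) = −iθ·conj G_{a,y}(s) + (e^{iθs})⁻¹(e^{iβs})⁻¹`.** [folklore] -/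
private theorem conj_anchorG' (a y s : ℝ) : conj (anchorG' a y s) =
    -(I * anchorTheta a) * conj (anchorG a y s) + (cexp (I * anchorTheta a * s))⁻¹ * (cexp (I * anchorFreq a y * s))⁻¹ := by
  rw [anchorG', map_add, map_mul, map_mul, Complex.conj_I, Complex.conj_ofReal, cexp_anchor_add, map_mul,
    conj_cexp_I_mul_mul, conj_cexp_I_mul_mul, neg_mul]

/-- `e^{i(α−β)s} = e^{iαs}(e^{iβs})⁻¹`. [folklore] -/
private theorem cexp_I_sub_mul (r r' s : ℝ) :
    cexp (I * (r - r') * s) = cexp (I * r * s) * (cexp (I * r' * s))⁻¹ := by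
  rw [← Complex.exp_neg, ← Complex.exp_add]; congr 1; ring

/-- `e^{−iβ s} = (e^{iβs})⁻¹` (written with the constant `−iβ` in front, the shape `integral_exp_mul_complex` wants).
[folklore] -/
private theorem cexp_neg_I_mul_mul (r s : ℝ) : cexp (-(I * r) * s) = (cexp (I * r * s))⁻¹ := by
  rw [← Complex.exp_neg]; congr 1; ring

/-- `e^{iβ/2} = (e^{−iβ/2})⁻¹`. [folklore] -/
private theorem cexp_I_mul_half (r : ℝ) : cexp (I * r / 2) = (cexp (-(I * r) / 2))⁻¹ := by
  rw [← Complex.exp_neg]; congr 1; ring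

/-- **The pointwise product identity** (all `s`; `x, y ≠ a`; `θ = πa/2`, `α = π(x−a)`, `β = π(y−a)`):
`G′_xḠ′_y − θ²G_xḠ_y = (1 + θ/α + θ/β)·e^{i(α−β)s} − (θ/α)e^{−iα/2}·e^{−iβs} − (θ/β)e^{iβ/2}·e^{iαs}` — the `θ²` terms
cancel and only three pure exponentials in `s` remain. [folklore] -/
private theorem anchor_integrand_eq {a x y : ℝ} (hx : x ≠ a) (hy : y ≠ a) (s : ℝ) :
    anchorG' a x s * conj (anchorG' a y s) - (anchorTheta a : ℂ) ^ 2 * (anchorG a x s * conj (anchorG a y s)) =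
      (1 + anchorTheta a / anchorFreq a x + anchorTheta a / anchorFreq a y) * cexp (I * (anchorFreq a x - anchorFreq a y) * s)
        - anchorTheta a / anchorFreq a x * cexp (-(I * anchorFreq a x) / 2) * cexp (-(I * anchorFreq a y) * s)
        - anchorTheta a / anchorFreq a y * cexp (I * anchorFreq a y / 2) * cexp (I * anchorFreq a x * s) := by
  have hα := anchorFreq_ne_zero hx
  have hβ := anchorFreq_ne_zero hy
  have hT : cexp (I * anchorTheta a * s) ≠ 0 := Complex.exp_ne_zero _
  have hB : cexp (I * anchorFreq a y * s) ≠ 0 := Complex.exp_ne_zero _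
  have hCb : cexp (-(I * anchorFreq a y) / 2) ≠ 0 := Complex.exp_ne_zero _
  rw [conj_anchorG', conj_anchorG, anchorG', anchorG, cexp_anchor_add, cexp_I_sub_mul, cexp_neg_I_mul_mul,
    cexp_I_mul_half]
  field_simp
  rw [Complex.I_sq]
  ring

/-! ### Part 2 — termwise integration and the moment identity `m₀(a;x,y) = −iπ·e^{iθ}·Pair(x,y)` -/

/-- `J(c) := ∫_{−½}^{½} e^{cs} ds`. [folklore] -/
def unitJ (c : ℂ) : ℂ := ∫ s in (-(1 / 2) : ℝ)..(1 / 2), cexp (c * s)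

/-- `J(c) = (e^{c/2} − e^{−c/2})/c` for `c ≠ 0`. [folklore] -/
private theorem unitJ_of_ne_zero {c : ℂ} (hc : c ≠ 0) :
    unitJ c = (cexp (c * ((1 / 2 : ℝ) : ℂ)) - cexp (c * ((-(1 / 2) : ℝ) : ℂ))) / c :=
  integral_exp_mul_complex hc

/-- `J(0) = 1`. [folklore] -/
private theorem unitJ_zero : unitJ 0 = 1 := by
  simp only [unitJ, zero_mul, Complex.exp_zero, intervalIntegral.integral_const]
  norm_num

/-- `s ↦ e^{cs}` is interval-integrable. [folklore] -/
private theorem intervalIntegrable_cexp_const_mul (c : ℂ) (u v : ℝ) :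
    IntervalIntegrable (fun s : ℝ => cexp (c * s)) volume u v :=
  (by fun_prop : Continuous fun s : ℝ => cexp (c * s)).intervalIntegrable _ _

/-- **Termwise integration of the product identity:**
`∫_{−½}^{½}(G′_xḠ′_y − θ²G_xḠ_y) = (1+θ/α+θ/β)·J(i(α−β)) − (θ/α)e^{−iα/2}·J(−iβ) − (θ/β)e^{iβ/2}·J(iα)`. [folklore] -/
private theorem integral_anchor_integrand {a x y : ℝ} (hx : x ≠ a) (hy : y ≠ a) :
    (∫ s in (-(1 / 2) : ℝ)..(1 / 2),
        (anchorG' a x s * conj (anchorG' a y s) - (anchorTheta a : ℂ) ^ 2 * (anchorG a x s * conj (anchorG a y s)))) =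
      (1 + anchorTheta a / anchorFreq a x + anchorTheta a / anchorFreq a y) *
          unitJ (I * (anchorFreq a x - anchorFreq a y))
        - anchorTheta a / anchorFreq a x * cexp (-(I * anchorFreq a x) / 2) * unitJ (-(I * anchorFreq a y))
        - anchorTheta a / anchorFreq a y * cexp (I * anchorFreq a y / 2) * unitJ (I * anchorFreq a x) := by
  rw [intervalIntegral.integral_congr (fun s _ => anchor_integrand_eq hx hy s)]
  have h1 := (intervalIntegrable_cexp_const_mul (I * (anchorFreq a x - anchorFreq a y)) (-(1 / 2)) (1 / 2)).const_mul
    (1 + anchorTheta a / anchorFreq a x + anchorTheta a / anchorFreq a y : ℂ)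
  have h2 := (intervalIntegrable_cexp_const_mul (-(I * anchorFreq a y)) (-(1 / 2)) (1 / 2)).const_mul
    (anchorTheta a / anchorFreq a x * cexp (-(I * anchorFreq a x) / 2) : ℂ)
  have h3 := (intervalIntegrable_cexp_const_mul (I * anchorFreq a x) (-(1 / 2)) (1 / 2)).const_mul
    (anchorTheta a / anchorFreq a y * cexp (I * anchorFreq a y / 2) : ℂ)
  rw [intervalIntegral.integral_sub (h1.sub h2) h3, intervalIntegral.integral_sub h1 h2,
    intervalIntegral.integral_const_mul, intervalIntegral.integral_const_mul, intervalIntegral.integral_const_mul]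
  rfl

/-- **The pair quantity `Pair_a(x,y) := ∫_{−½}^{½}(G′_xḠ′_y − θ²G_xḠ_y) ds − iθ·G_x(½)Ḡ_y(½)`** — the Hermitian
form whose real part on the diagonal is the ground-state quadratic form of Part 3. [folklore] -/
def anchorPair (a x y : ℝ) : ℂ :=
  (∫ s in (-(1 / 2) : ℝ)..(1 / 2),
      (anchorG' a x s * conj (anchorG' a y s) - (anchorTheta a : ℂ) ^ 2 * (anchorG a x s * conj (anchorG a y s))))
    - I * anchorTheta a * (anchorG a x (1 / 2) * conj (anchorG a y (1 / 2)))

/-- `e^{iπ(B−a)} = e^{iθ}·(e^{−iα/2})⁻¹·(e^{−iβ/2})⁻¹` for `B = (a+x+y)/2`. [folklore] -/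
private theorem cexp_B_sub_a (a x y : ℝ) : cexp (I * π * (((a + x + y) / 2 - a : ℝ) : ℂ)) =
    cexp (I * anchorTheta a) * (cexp (-(I * anchorFreq a x) / 2))⁻¹ * (cexp (-(I * anchorFreq a y) / 2))⁻¹ := by
  rw [← Complex.exp_neg, ← Complex.exp_neg, ← Complex.exp_add, ← Complex.exp_add]
  congr 1; simp only [anchorTheta, anchorFreq]; push_cast; ring

/-- `e^{iπ(B−x)} = e^{iθ}·e^{−iα/2}·(e^{−iβ/2})⁻¹`. [folklore] -/
private theorem cexp_B_sub_x (a x y : ℝ) : cexp (I * π * (((a + x + y) / 2 - x : ℝ) : ℂ)) =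
    cexp (I * anchorTheta a) * cexp (-(I * anchorFreq a x) / 2) * (cexp (-(I * anchorFreq a y) / 2))⁻¹ := by
  rw [← Complex.exp_neg, ← Complex.exp_add, ← Complex.exp_add]
  congr 1; simp only [anchorTheta, anchorFreq]; push_cast; ring

/-- `e^{iπ(B−y)} = e^{iθ}·(e^{−iα/2})⁻¹·e^{−iβ/2}`. [folklore] -/
private theorem cexp_B_sub_y (a x y : ℝ) : cexp (I * π * (((a + x + y) / 2 - y : ℝ) : ℂ)) =
    cexp (I * anchorTheta a) * (cexp (-(I * anchorFreq a x) / 2))⁻¹ * cexp (-(I * anchorFreq a y) / 2) := by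
  rw [← Complex.exp_neg, ← Complex.exp_add, ← Complex.exp_add]
  congr 1; simp only [anchorTheta, anchorFreq]; push_cast; ring

/-- `e^{ir·½} = (e^{−ir/2})⁻¹`. [folklore] -/
private theorem cexp_I_mul_at_half (r : ℝ) : cexp (I * r * ((1 / 2 : ℝ) : ℂ)) = (cexp (-(I * r) / 2))⁻¹ := by
  rw [← Complex.exp_neg]; congr 1; push_cast; ring

/-- `e^{ir·(−½)} = e^{−ir/2}`. [folklore] -/
private theorem cexp_I_mul_at_neg_half (r : ℝ) : cexp (I * r * ((-(1 / 2) : ℝ) : ℂ)) = cexp (-(I * r) / 2) := by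
  congr 1; push_cast; ring

/-- `e^{−ir·½} = e^{−ir/2}`. [folklore] -/
private theorem cexp_neg_I_mul_at_half (r : ℝ) : cexp (-(I * r) * ((1 / 2 : ℝ) : ℂ)) = cexp (-(I * r) / 2) := by
  congr 1; push_cast; ring

/-- `e^{−ir·(−½)} = (e^{−ir/2})⁻¹`. [folklore] -/
private theorem cexp_neg_I_mul_at_neg_half (r : ℝ) :
    cexp (-(I * r) * ((-(1 / 2) : ℝ) : ℂ)) = (cexp (-(I * r) / 2))⁻¹ := by
  rw [← Complex.exp_neg]; congr 1; push_cast; ring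

/-- `e^{i(r−r′)·½} = (e^{−ir/2})⁻¹·e^{−ir′/2}`. [folklore] -/
private theorem cexp_I_sub_at_half (r r' : ℝ) : cexp (I * (r - r') * ((1 / 2 : ℝ) : ℂ)) =
    (cexp (-(I * r) / 2))⁻¹ * cexp (-(I * r') / 2) := by
  rw [← Complex.exp_neg, ← Complex.exp_add]; congr 1; push_cast; ring

/-- `e^{i(r−r′)·(−½)} = e^{−ir/2}·(e^{−ir′/2})⁻¹`. [folklore] -/
private theorem cexp_I_sub_at_neg_half (r r' : ℝ) : cexp (I * (r - r') * ((-(1 / 2) : ℝ) : ℂ)) =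
    cexp (-(I * r) / 2) * (cexp (-(I * r') / 2))⁻¹ := by
  rw [← Complex.exp_neg, ← Complex.exp_add]; congr 1; push_cast; ring

/-- `G_x(½) = e^{iθ/2}·((e^{−iα/2})⁻¹ − e^{−iα/2})/(iα)`. [folklore] -/
private theorem anchorG_half (a x : ℝ) : anchorG a x (1 / 2) =
    cexp (I * anchorTheta a * ((1 / 2 : ℝ) : ℂ)) *
      (((cexp (-(I * anchorFreq a x) / 2))⁻¹ - cexp (-(I * anchorFreq a x) / 2)) / (I * anchorFreq a x)) := by
  rw [anchorG, cexp_I_mul_at_half (anchorFreq a x)]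

/-- `conj G_y(½) = (e^{iθ/2})⁻¹·(e^{−iβ/2} − (e^{−iβ/2})⁻¹)/(−iβ)`. [folklore] -/
private theorem conj_anchorG_half (a y : ℝ) : conj (anchorG a y (1 / 2)) =
    (cexp (I * anchorTheta a * ((1 / 2 : ℝ) : ℂ)))⁻¹ *
      ((cexp (-(I * anchorFreq a y) / 2) - (cexp (-(I * anchorFreq a y) / 2))⁻¹) / (-(I * anchorFreq a y))) := by
  rw [conj_anchorG, cexp_I_mul_at_half (anchorFreq a y), inv_inv]

/-- **The moment identity at pairwise-distinct nodes** `x ≠ y`, `x, y ≠ a`: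
`m₀(a;x,y) = Det.ddM0 ![a,x,y] = −iπ·e^{iθ}·Pair_a(x,y)` (three-term residue formula `Det.dd2_of_ne` on the left,
termwise integration on the right; an identity of Laurent polynomials in `e^{iθ}, e^{−iα/2}, e^{−iβ/2}`).
[cite: Zhang2022LandauSiegel, proof of Prop 7.1, (7.19)–(7.21)] -/
theorem ddM0_eq_anchorPair_of_ne {a x y : ℝ} (hx : x ≠ a) (hy : y ≠ a) (hxy : x ≠ y) :
    ddM0 ![a, x, y] = -I * π * cexp (I * anchorTheta a) * anchorPair a x y := by
  have hα := anchorFreq_ne_zero hx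
  have hβ := anchorFreq_ne_zero hy
  have hαβ : (anchorFreq a x : ℂ) - anchorFreq a y ≠ 0 := by
    rw [sub_ne_zero]; unfold anchorFreq
    exact_mod_cast fun h => hxy (by have := mul_left_cancel₀ pi_ne_zero h; linarith)
  have hIαβ : I * ((anchorFreq a x : ℂ) - anchorFreq a y) ≠ 0 := mul_ne_zero I_ne_zero hαβ
  have hIα : I * (anchorFreq a x : ℂ) ≠ 0 := mul_ne_zero I_ne_zero hα
  have hIβ : -(I * (anchorFreq a y : ℂ)) ≠ 0 := neg_ne_zero.mpr (mul_ne_zero I_ne_zero hβ)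
  have hP : cexp (I * anchorTheta a) ≠ 0 := Complex.exp_ne_zero _
  have hT : cexp (I * anchorTheta a * ((1 / 2 : ℝ) : ℂ)) ≠ 0 := Complex.exp_ne_zero _
  have hCa : cexp (-(I * anchorFreq a x) / 2) ≠ 0 := Complex.exp_ne_zero _
  have hCb : cexp (-(I * anchorFreq a y) / 2) ≠ 0 := Complex.exp_ne_zero _
  have hπ : (π : ℂ) ≠ 0 := by exact_mod_cast pi_ne_zero
  -- left-hand side: the three-term residue formula
  have lhs : ddM0 ![a, x, y] =
      a * cexp (I * π * (((a + x + y) / 2 - a : ℝ) : ℂ)) / (((x - a) * (y - a) : ℝ) : ℂ)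
        + x * cexp (I * π * (((a + x + y) / 2 - x : ℝ) : ℂ)) / (((a - x) * (y - x) : ℝ) : ℂ)
        + y * cexp (I * π * (((a + x + y) / 2 - y : ℝ) : ℂ)) / (((a - y) * (x - y) : ℝ) : ℂ) := by
    simp only [ddM0, ddOf, shiftB, Matrix.cons_val_zero, Matrix.cons_val_one, Matrix.cons_val_two, Matrix.head_cons,
      Matrix.tail_cons]
    rw [dd2_of_ne _ _ _ (Ne.symm hx) hxy (Ne.symm hy)]
    simp only [ddBase, pow_one]
  rw [lhs, cexp_B_sub_a, cexp_B_sub_x, cexp_B_sub_y, anchorPair, integral_anchor_integrand hx hy,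
    unitJ_of_ne_zero hIαβ, unitJ_of_ne_zero hIβ, unitJ_of_ne_zero hIα, cexp_I_sub_at_half, cexp_I_sub_at_neg_half,
    cexp_neg_I_mul_at_half, cexp_neg_I_mul_at_neg_half, cexp_I_mul_at_half, cexp_I_mul_at_neg_half, cexp_I_mul_half,
    anchorG_half, conj_anchorG_half]
  push_cast
  -- express the nodes through the frequencies: a = 2θ/π, x = (2θ + α)/π, y = (2θ + β)/π
  have ha' : (a : ℂ) = 2 * anchorTheta a / π := by
    simp only [anchorTheta]; push_cast; field_simp
  have hx' : (x : ℂ) = 2 * anchorTheta a / π + anchorFreq a x / π := by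
    simp only [anchorTheta, anchorFreq]; push_cast; field_simp; ring
  have hy' : (y : ℂ) = 2 * anchorTheta a / π + anchorFreq a y / π := by
    simp only [anchorTheta, anchorFreq]; push_cast; field_simp; ring
  have hβα : (anchorFreq a y : ℂ) - anchorFreq a x ≠ 0 := fun h => hαβ (by rw [← neg_sub, h, neg_zero])
  -- the three residue denominators through the frequencies
  have d1 : ((x : ℂ) - a) * (y - a) = anchorFreq a x * anchorFreq a y / π ^ 2 := by
    simp only [anchorFreq]; push_cast; field_simp
  have d2 : ((a : ℂ) - x) * (y - x) = anchorFreq a x * (anchorFreq a x - anchorFreq a y) / π ^ 2 := by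
    simp only [anchorFreq]; push_cast; field_simp; ring
  have d3 : ((a : ℂ) - y) * (x - y) = anchorFreq a y * (anchorFreq a y - anchorFreq a x) / π ^ 2 := by
    simp only [anchorFreq]; push_cast; field_simp; ring
  rw [d1, d2, d3, hx', hy', ha']
  field_simp
  ring_nf

/-- `h[p,q,q]` for `p ≠ q` — the confluent branch of `Det.dd2` used on the diagonal `y = x`. [folklore] -/
private theorem dd2_right' (h h' h'' : ℝ → ℂ) {x y : ℝ} (hxy : x ≠ y) :
    dd2 h h' h'' x y y = ((h x - h y) / ((x - y : ℝ) : ℂ) - h' y) / ((x - y : ℝ) : ℂ) := by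
  rw [dd2, if_neg (fun hh => hh.2.1 rfl), if_neg (fun hh => hxy hh.1), if_neg hxy, if_pos rfl]

/-- **The moment identity on the confluent diagonal** `y = x ≠ a`:
`m₀(a;x,x) = Det.ddM0 ![a,x,x] = −iπ·e^{iθ}·Pair_a(x,x)` (the tree's confluent branch of `Det.dd2` on the left —
`((h(a) − h(x))/(a − x) − h′(x))/(a − x)` with `h(t) = t e^{iπ(B−t)}` — and `J(0) = 1` on the right).
[cite: Zhang2022LandauSiegel, proof of Prop 7.1, (7.19)–(7.21)] -/
theorem ddM0_eq_anchorPair_self {a x : ℝ} (hx : x ≠ a) :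
    ddM0 ![a, x, x] = -I * π * cexp (I * anchorTheta a) * anchorPair a x x := by
  have hα := anchorFreq_ne_zero hx
  have hIα : I * (anchorFreq a x : ℂ) ≠ 0 := mul_ne_zero I_ne_zero hα
  have hIα' : -(I * (anchorFreq a x : ℂ)) ≠ 0 := neg_ne_zero.mpr hIα
  have hP : cexp (I * anchorTheta a) ≠ 0 := Complex.exp_ne_zero _
  have hT : cexp (I * anchorTheta a * ((1 / 2 : ℝ) : ℂ)) ≠ 0 := Complex.exp_ne_zero _
  have hCa : cexp (-(I * anchorFreq a x) / 2) ≠ 0 := Complex.exp_ne_zero _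
  have hπ : (π : ℂ) ≠ 0 := by exact_mod_cast pi_ne_zero
  -- left-hand side: the confluent branch
  have lhs : ddM0 ![a, x, x] =
      ((a * cexp (I * π * (((a + x + x) / 2 - a : ℝ) : ℂ)) - x * cexp (I * π * (((a + x + x) / 2 - x : ℝ) : ℂ)))
          / ((a - x : ℝ) : ℂ)
        - (1 - I * π * x) * cexp (I * π * (((a + x + x) / 2 - x : ℝ) : ℂ))) / ((a - x : ℝ) : ℂ) := by
    simp only [ddM0, ddOf, shiftB, Matrix.cons_val_zero, Matrix.cons_val_one, Matrix.cons_val_two, Matrix.head_cons,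
      Matrix.tail_cons]
    rw [dd2_right' _ _ _ (Ne.symm hx)]
    simp only [ddBase, ddBase', pow_one, Nat.sub_self, pow_zero, Nat.cast_one, mul_one]
  rw [lhs, cexp_B_sub_a, cexp_B_sub_x, anchorPair, integral_anchor_integrand hx hx, sub_self, mul_zero, unitJ_zero,
    unitJ_of_ne_zero hIα', unitJ_of_ne_zero hIα, cexp_neg_I_mul_at_half, cexp_neg_I_mul_at_neg_half,
    cexp_I_mul_at_half, cexp_I_mul_at_neg_half, cexp_I_mul_half, conj_anchorG_half, anchorG_half]
  push_cast
  have ha' : (a : ℂ) = 2 * anchorTheta a / π := by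
    simp only [anchorTheta]; push_cast; field_simp
  have hx' : (x : ℂ) = 2 * anchorTheta a / π + anchorFreq a x / π := by
    simp only [anchorTheta, anchorFreq]; push_cast; field_simp; ring
  have d1 : ((a : ℂ) - x) = -anchorFreq a x / π := by
    simp only [anchorFreq]; push_cast; field_simp; ring
  rw [d1, hx', ha']
  field_simp
  ring_nf

/-! ### Part 3 — the ground-state (Picone) inequality on `[−½, ½]` with the sharp Robin constant `θ cot θ` -/

/-- The shifted ground-state weight `w_δ(s) = θ·cot(θ(s + ½ + δ)) = φ′/φ` for `φ(s) = sin(θ(s+½+δ))`. [folklore] -/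
def gsWeight (θ δ s : ℝ) : ℝ := θ * Real.cos (θ * (s + 1 / 2 + δ)) / Real.sin (θ * (s + 1 / 2 + δ))

/-- On `[−½, ½]` the phase `θ(s+½+δ)` lies in `(0, π)` when `θ > 0`, `δ > 0`, `θ(1+δ) < π`, so its sine is positive.
[folklore] -/
private theorem sin_gsPhase_pos {θ δ s : ℝ} (hθ : 0 < θ) (hδ : 0 < δ) (hθδ : θ * (1 + δ) < π)
    (hs : s ∈ Icc (-(1 / 2) : ℝ) (1 / 2)) : 0 < Real.sin (θ * (s + 1 / 2 + δ)) := by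
  apply Real.sin_pos_of_pos_of_lt_pi
  · exact mul_pos hθ (by linarith [hs.1])
  · calc θ * (s + 1 / 2 + δ) ≤ θ * (1 + δ) := by
          apply mul_le_mul_of_nonneg_left _ hθ.le; linarith [hs.2]
      _ < π := hθδ

/-- **Riccati equation of the weight:** `w_δ′ = −θ² − w_δ²` wherever the sine does not vanish. [folklore] -/
private theorem hasDerivAt_gsWeight {θ δ s : ℝ} (hs : Real.sin (θ * (s + 1 / 2 + δ)) ≠ 0) :
    HasDerivAt (fun t => gsWeight θ δ t) (-θ ^ 2 - gsWeight θ δ s ^ 2) s := by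
  have hu : HasDerivAt (fun t : ℝ => θ * (t + 1 / 2 + δ)) θ s := by
    have := ((hasDerivAt_id s).add_const (1 / 2 + δ)).const_mul θ
    simpa [mul_one, add_assoc] using this
  have hcos := (Real.hasDerivAt_cos _).comp s hu
  have hsin := (Real.hasDerivAt_sin _).comp s hu
  have h := ((hcos.const_mul θ).div hsin hs)
  have e1 : (fun t => gsWeight θ δ t) = fun t => θ * Real.cos (θ * (t + 1 / 2 + δ)) / Real.sin (θ * (t + 1 / 2 + δ)) := by
    funext t; rfl
  rw [e1]
  refine h.congr_deriv ?_
  simp only [gsWeight, Function.comp_def]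
  set u := θ * (s + 1 / 2 + δ) with hu_def
  field_simp

/-- The weight is continuous on `[−½, ½]` (for `θ > 0`, `δ > 0`, `θ(1+δ) < π`). [folklore] -/
private theorem continuousOn_gsWeight {θ δ : ℝ} (hθ : 0 < θ) (hδ : 0 < δ) (hθδ : θ * (1 + δ) < π) :
    ContinuousOn (fun s => gsWeight θ δ s) (Icc (-(1 / 2) : ℝ) (1 / 2)) := by
  unfold gsWeight
  apply ContinuousOn.div (by fun_prop) (by fun_prop)
  intro s hs
  exact (sin_gsPhase_pos hθ hδ hθδ hs).ne'

/-- **Pointwise Picone identity/inequality:** for a real weight `w` with derivative `wd = −θ² − w²` and complex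
values `z = f(s)`, `v = f′(s)`: `wd·‖z‖² + w·2⟪z, v⟫ ≤ ‖v‖² − θ²‖z‖²`, the defect being `‖v − w·z‖² ≥ 0`.
[folklore] -/
private theorem picone_pointwise (θ w : ℝ) (z v : ℂ) :
    (-θ ^ 2 - w ^ 2) * ‖z‖ ^ 2 + w * (2 * (v * conj z).re) ≤ ‖v‖ ^ 2 - θ ^ 2 * ‖z‖ ^ 2 := by
  have key : ‖v‖ ^ 2 - θ ^ 2 * ‖z‖ ^ 2 - ((-θ ^ 2 - w ^ 2) * ‖z‖ ^ 2 + w * (2 * (v * conj z).re))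
      = ‖v - w * z‖ ^ 2 := by
    simp only [Complex.sq_norm, Complex.normSq_apply, Complex.mul_re, Complex.mul_im, Complex.conj_re,
      Complex.conj_im, Complex.sub_re, Complex.sub_im, Complex.ofReal_re, Complex.ofReal_im]
    ring
  nlinarith [key, sq_nonneg ‖v - w * z‖]

/-- **THE GROUND-STATE INEQUALITY** (sharp; equality for `f(s) = sin(θ(s+½))`): for `θ ∈ (0, π)` and every `C¹`
path `f : ℝ → ℂ` with `f(−½) = 0`,
`θ cos θ · ‖f(½)‖² ≤ sin θ · ∫_{−½}^{½} (‖f′‖² − θ²‖f‖²)`.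
Proof: Picone with the shifted ground state `sin(θ(s+½+δ))` (no division by a vanishing weight), then `δ ↓ 0`.
This is the positivity of the Dirichlet–Robin form whose lowest eigenvalue is exactly `θ²` — a Wirtinger-type
inequality proved by the factorisation method of Hardy–Littlewood–Pólya §7.7.
[cite: HardyLittlewoodPolya1952, §7.7 Theorems 256–257 (Wirtinger's inequality; factorisation method)] -/
theorem groundState_ineq {θ : ℝ} (hθ : 0 < θ) (hθπ : θ < π) {f f' : ℝ → ℂ}
    (hf : ∀ s, HasDerivAt f (f' s) s) (hf' : Continuous f') (h0 : f (-(1 / 2)) = 0) :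
    θ * Real.cos θ * ‖f (1 / 2)‖ ^ 2 ≤
      Real.sin θ * ∫ s in (-(1 / 2) : ℝ)..(1 / 2), (‖f' s‖ ^ 2 - θ ^ 2 * ‖f s‖ ^ 2) := by
  have hfc : Continuous f := continuous_iff_continuousAt.mpr fun s => (hf s).continuousAt
  have hle : (-(1 / 2) : ℝ) ≤ 1 / 2 := by norm_num
  -- the integrand on the right is continuous, hence integrable
  have hR : IntervalIntegrable (fun s => ‖f' s‖ ^ 2 - θ ^ 2 * ‖f s‖ ^ 2) volume (-(1 / 2)) (1 / 2) :=
    (by fun_prop : Continuous fun s => ‖f' s‖ ^ 2 - θ ^ 2 * ‖f s‖ ^ 2).intervalIntegrable _ _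
  -- Step 1: for every small δ > 0, the δ-shifted Picone bound
  have step : ∀ δ : ℝ, 0 < δ → θ * (1 + δ) < π →
      θ * Real.cos (θ * (1 + δ)) / Real.sin (θ * (1 + δ)) * ‖f (1 / 2)‖ ^ 2 ≤
        ∫ s in (-(1 / 2) : ℝ)..(1 / 2), (‖f' s‖ ^ 2 - θ ^ 2 * ‖f s‖ ^ 2) := by
    intro δ hδ hθδ
    have hsin : ∀ s ∈ Icc (-(1 / 2) : ℝ) (1 / 2), Real.sin (θ * (s + 1 / 2 + δ)) ≠ 0 :=
      fun s hs => (sin_gsPhase_pos hθ hδ hθδ hs).ne'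
    -- Φ(s) = w_δ(s)‖f(s)‖² and its derivative
    have hΦ : ∀ s ∈ uIcc (-(1 / 2) : ℝ) (1 / 2),
        HasDerivAt (fun t => gsWeight θ δ t * ‖f t‖ ^ 2)
          ((-θ ^ 2 - gsWeight θ δ s ^ 2) * ‖f s‖ ^ 2 + gsWeight θ δ s * (2 * (f' s * conj (f s)).re)) s := by
      intro s hs
      rw [uIcc_of_le hle] at hs
      have h1 := hasDerivAt_gsWeight (hsin s hs)
      have h2 : HasDerivAt (fun t => ‖f t‖ ^ 2) (2 * (f' s * conj (f s)).re) s := by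
        have := (hf s).norm_sq
        simpa only [Complex.inner] using this
      exact h1.mul h2
    have hΦ'cont : ContinuousOn (fun s => (-θ ^ 2 - gsWeight θ δ s ^ 2) * ‖f s‖ ^ 2
        + gsWeight θ δ s * (2 * (f' s * conj (f s)).re)) (uIcc (-(1 / 2) : ℝ) (1 / 2)) := by
      rw [uIcc_of_le hle]
      have hw := continuousOn_gsWeight hθ hδ hθδ
      apply ContinuousOn.add
      · exact ((continuousOn_const.sub (hw.pow 2)).mul ((hfc.norm.pow 2).continuousOn))
      · apply hw.mul
        exact (continuous_const.mul (Complex.continuous_re.comp (hf'.mul hfc.star))).continuousOn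
    have hΦ'int : IntervalIntegrable (fun s => (-θ ^ 2 - gsWeight θ δ s ^ 2) * ‖f s‖ ^ 2
        + gsWeight θ δ s * (2 * (f' s * conj (f s)).re)) volume (-(1 / 2)) (1 / 2) :=
      hΦ'cont.intervalIntegrable
    -- FTC: ∫ Φ′ = Φ(½) − Φ(−½) = w_δ(½)‖f(½)‖²
    have hFTC := intervalIntegral.integral_eq_sub_of_hasDerivAt hΦ hΦ'int
    -- pointwise Picone: Φ′ ≤ ‖f′‖² − θ²‖f‖²
    have hmono := intervalIntegral.integral_mono_on hle hΦ'int hR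
      (fun s _ => picone_pointwise θ (gsWeight θ δ s) (f s) (f' s))
    have ew : gsWeight θ δ (1 / 2) = θ * Real.cos (θ * (1 + δ)) / Real.sin (θ * (1 + δ)) := by
      simp only [gsWeight]; norm_num
    rw [hFTC] at hmono
    simp only [h0, norm_zero, ne_eq, OfNat.ofNat_ne_zero, not_false_eq_true, zero_pow, mul_zero, sub_zero,
      ew] at hmono
    exact hmono
  -- Step 2: let δ ↓ 0
  have hδ₀ : 0 < (π - θ) / (2 * θ) := div_pos (by linarith) (by linarith)
  have hev : ∀ᶠ δ in 𝓝[>] (0 : ℝ),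
      Real.sin θ * (θ * Real.cos (θ * (1 + δ)) / Real.sin (θ * (1 + δ)) * ‖f (1 / 2)‖ ^ 2) ≤
        Real.sin θ * ∫ s in (-(1 / 2) : ℝ)..(1 / 2), (‖f' s‖ ^ 2 - θ ^ 2 * ‖f s‖ ^ 2) := by
    filter_upwards [Ioo_mem_nhdsGT hδ₀] with δ hδ
    have hθδ : θ * (1 + δ) < π := by
      have h2 : θ * δ < (π - θ) / 2 := by
        have := hδ.2
        calc θ * δ < θ * ((π - θ) / (2 * θ)) := mul_lt_mul_of_pos_left this hθ
          _ = (π - θ) / 2 := by field_simp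
      nlinarith
    exact mul_le_mul_of_nonneg_left (step δ hδ.1 hθδ) (Real.sin_pos_of_pos_of_lt_pi hθ hθπ).le
  have hsinθ : Real.sin θ ≠ 0 := (Real.sin_pos_of_pos_of_lt_pi hθ hθπ).ne'
  have hlim : Tendsto (fun δ : ℝ => Real.sin θ * (θ * Real.cos (θ * (1 + δ)) / Real.sin (θ * (1 + δ)) * ‖f (1 / 2)‖ ^ 2))
      (𝓝[>] (0 : ℝ)) (𝓝 (Real.sin θ * (θ * Real.cos (θ * (1 + 0)) / Real.sin (θ * (1 + 0)) * ‖f (1 / 2)‖ ^ 2))) := by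
    apply tendsto_nhdsWithin_of_tendsto_nhds
    have hc : ContinuousAt (fun δ : ℝ => Real.sin θ * (θ * Real.cos (θ * (1 + δ)) / Real.sin (θ * (1 + δ)) * ‖f (1 / 2)‖ ^ 2)) 0 := by
      have hs0 : Real.sin (θ * (1 + (0 : ℝ))) ≠ 0 := by simpa using hsinθ
      fun_prop (disch := exact hs0)
    exact hc.tendsto
  have := le_of_tendsto hlim hev
  have e : Real.sin θ * (θ * Real.cos (θ * (1 + 0)) / Real.sin (θ * (1 + 0)) * ‖f (1 / 2)‖ ^ 2)
      = θ * Real.cos θ * ‖f (1 / 2)‖ ^ 2 := by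
    simp only [add_zero, mul_one]; field_simp
  rwa [e] at this

/-! ### Part 4 — summation against real coefficients, the real part, and L-B′1 on the whole line -/

/-- The moment identity at every pair of nodes `x, y ≠ a` (generic and confluent together).
[cite: Zhang2022LandauSiegel, proof of Prop 7.1, (7.19)–(7.21)] -/
theorem ddM0_eq_anchorPair {a x y : ℝ} (hx : x ≠ a) (hy : y ≠ a) :
    ddM0 ![a, x, y] = -I * π * cexp (I * anchorTheta a) * anchorPair a x y := by
  rcases eq_or_ne x y with h | h
  · subst h; exact ddM0_eq_anchorPair_self hx
  · exact ddM0_eq_anchorPair_of_ne hx hy h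

/-- The pair integrand `F_{x,y}(s) = G′_x Ḡ′_y − θ² G_x Ḡ_y`. [folklore] -/
def anchorIntegrand (a x y s : ℝ) : ℂ :=
  anchorG' a x s * conj (anchorG' a y s) - (anchorTheta a : ℂ) ^ 2 * (anchorG a x s * conj (anchorG a y s))

/-- `Pair_a(x,y) = ∫_{−½}^{½} F_{x,y} − iθ·G_x(½)Ḡ_y(½)` (definitional unfolding). [folklore] -/
private theorem anchorPair_eq (a x y : ℝ) : anchorPair a x y =
    (∫ s in (-(1 / 2) : ℝ)..(1 / 2), anchorIntegrand a x y s)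
      - I * anchorTheta a * (anchorG a x (1 / 2) * conj (anchorG a y (1 / 2))) := rfl

/-- The pair integrand is continuous in `s`. [folklore] -/
private theorem continuous_anchorIntegrand (a x y : ℝ) : Continuous fun s => anchorIntegrand a x y s := by
  unfold anchorIntegrand
  have h1 := continuous_anchorG a x
  have h2 := continuous_anchorG' a x
  have h3 := Complex.continuous_conj.comp (continuous_anchorG a y)
  have h4 := Complex.continuous_conj.comp (continuous_anchorG' a y)
  exact (h2.mul h4).sub (continuous_const.mul (h1.mul h3))

/-- The summed primitive `𝒢 = Σ_j p_j·G_{a,x_j}`. [folklore] -/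
def anchorSumG (a : ℝ) {n : ℕ} (x p : Fin n → ℝ) (s : ℝ) : ℂ := ∑ j, (p j : ℂ) * anchorG a (x j) s

/-- Its derivative `𝒢′ = Σ_j p_j·G′_{a,x_j}`. [folklore] -/
def anchorSumG' (a : ℝ) {n : ℕ} (x p : Fin n → ℝ) (s : ℝ) : ℂ := ∑ j, (p j : ℂ) * anchorG' a (x j) s

/-- `𝒢′` is the derivative of `𝒢` (all nodes `≠ a`). [folklore] -/
private theorem hasDerivAt_anchorSumG {a : ℝ} {n : ℕ} {x : Fin n → ℝ} (p : Fin n → ℝ) (hx : ∀ j, x j ≠ a) (s : ℝ) :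
    HasDerivAt (fun t => anchorSumG a x p t) (anchorSumG' a x p s) s := by
  have := HasDerivAt.fun_sum (u := Finset.univ) fun j _ => (hasDerivAt_anchorG (hx j) s).const_mul (p j : ℂ)
  simpa [anchorSumG, anchorSumG'] using this

/-- `𝒢(−½) = 0`. [folklore] -/
private theorem anchorSumG_neg_half (a : ℝ) {n : ℕ} (x p : Fin n → ℝ) : anchorSumG a x p (-(1 / 2)) = 0 := by
  simp only [anchorSumG, anchorG_neg_half, mul_zero, Finset.sum_const_zero]

/-- `𝒢` is continuous. [folklore] -/
private theorem continuous_anchorSumG (a : ℝ) {n : ℕ} (x p : Fin n → ℝ) : Continuous fun s => anchorSumG a x p s := by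
  unfold anchorSumG
  exact continuous_finsetSum _ fun j _ => continuous_const.mul (continuous_anchorG a (x j))

/-- `𝒢′` is continuous. [folklore] -/
private theorem continuous_anchorSumG' (a : ℝ) {n : ℕ} (x p : Fin n → ℝ) : Continuous fun s => anchorSumG' a x p s := by
  unfold anchorSumG'
  exact continuous_finsetSum _ fun j _ => continuous_const.mul (continuous_anchorG' a (x j))

/-- Bilinear bookkeeping: `Σ_j Σ_l p_j p_l·(A_j·conj B_l) = (Σ_j p_j A_j)·conj(Σ_l p_l B_l)` for real `p`. [folklore] -/
private theorem sum_sum_mul_conj {n : ℕ} (p : Fin n → ℝ) (A B : Fin n → ℂ) :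
    ∑ j, ∑ l, (p j : ℂ) * p l * (A j * conj (B l)) = (∑ j, (p j : ℂ) * A j) * conj (∑ l, (p l : ℂ) * B l) := by
  rw [map_sum, Finset.sum_mul_sum]
  refine Finset.sum_congr rfl fun j _ => Finset.sum_congr rfl fun l _ => ?_
  rw [map_mul, Complex.conj_ofReal]; ring

/-- The summed integrand is the double sum of the pair integrands. [folklore] -/
private theorem anchorSum_integrand_eq (a : ℝ) {n : ℕ} (x p : Fin n → ℝ) (s : ℝ) :
    anchorSumG' a x p s * conj (anchorSumG' a x p s)
        - (anchorTheta a : ℂ) ^ 2 * (anchorSumG a x p s * conj (anchorSumG a x p s)) =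
      ∑ j, ∑ l, (p j : ℂ) * p l * anchorIntegrand a (x j) (x l) s := by
  simp only [anchorSumG, anchorSumG', anchorIntegrand, ← sum_sum_mul_conj, Finset.mul_sum, ← Finset.sum_sub_distrib]
  refine Finset.sum_congr rfl fun j _ => Finset.sum_congr rfl fun l _ => ?_
  ring

/-- **The summed moment identity** (all nodes `≠ a`):
`Σ_j Σ_l p_j p_l·m₀(a;x_j,x_l) = −iπe^{iθ}·( ∫_{−½}^{½}(𝒢′·conj 𝒢′ − θ²·𝒢·conj 𝒢) − iθ·𝒢(½)·conj 𝒢(½) )`.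
[cite: Zhang2022LandauSiegel, proof of Prop 7.1, (7.19)–(7.21)] -/
theorem sum_ddM0_eq {a : ℝ} {n : ℕ} {x : Fin n → ℝ} (p : Fin n → ℝ) (hx : ∀ j, x j ≠ a) :
    ∑ j, ∑ l, (p j : ℂ) * p l * ddM0 ![a, x j, x l] =
      -I * π * cexp (I * anchorTheta a) *
        ((∫ s in (-(1 / 2) : ℝ)..(1 / 2), (anchorSumG' a x p s * conj (anchorSumG' a x p s)
            - (anchorTheta a : ℂ) ^ 2 * (anchorSumG a x p s * conj (anchorSumG a x p s))))
          - I * anchorTheta a * (anchorSumG a x p (1 / 2) * conj (anchorSumG a x p (1 / 2)))) := by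
  -- Step 1: each moment through its pair quantity; pull the common factor out of the double sum
  have h1 : ∑ j, ∑ l, (p j : ℂ) * p l * ddM0 ![a, x j, x l] =
      -I * π * cexp (I * anchorTheta a) * ∑ j, ∑ l, (p j : ℂ) * p l * anchorPair a (x j) (x l) := by
    rw [Finset.mul_sum]
    refine Finset.sum_congr rfl fun j _ => ?_
    rw [Finset.mul_sum]
    refine Finset.sum_congr rfl fun l _ => ?_
    rw [ddM0_eq_anchorPair (hx j) (hx l)]; ring
  rw [h1]
  congr 1
  -- Step 2: bilinearity
  have hF : ∀ j l, IntervalIntegrable (fun s => (p j : ℂ) * p l * anchorIntegrand a (x j) (x l) s)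
      volume (-(1 / 2)) (1 / 2) :=
    fun j l => (continuous_const.mul (continuous_anchorIntegrand a (x j) (x l))).intervalIntegrable _ _
  have hrow : ∀ j, IntervalIntegrable (fun s => ∑ l, (p j : ℂ) * p l * anchorIntegrand a (x j) (x l) s)
      volume (-(1 / 2)) (1 / 2) :=
    fun j => (continuous_finsetSum _ fun l _ =>
      continuous_const.mul (continuous_anchorIntegrand a (x j) (x l))).intervalIntegrable _ _
  calc ∑ j, ∑ l, (p j : ℂ) * p l * anchorPair a (x j) (x l)
      = ∑ j, ∑ l, ((p j : ℂ) * p l * (∫ s in (-(1 / 2) : ℝ)..(1 / 2), anchorIntegrand a (x j) (x l) s)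
          - I * anchorTheta a * ((p j : ℂ) * p l * (anchorG a (x j) (1 / 2) * conj (anchorG a (x l) (1 / 2))))) := by
        refine Finset.sum_congr rfl fun j _ => Finset.sum_congr rfl fun l _ => ?_
        rw [anchorPair_eq]; ring
    _ = (∑ j, ∑ l, (p j : ℂ) * p l * ∫ s in (-(1 / 2) : ℝ)..(1 / 2), anchorIntegrand a (x j) (x l) s)
          - I * anchorTheta a *
            ∑ j, ∑ l, (p j : ℂ) * p l * (anchorG a (x j) (1 / 2) * conj (anchorG a (x l) (1 / 2))) := by
        simp only [Finset.sum_sub_distrib, Finset.mul_sum]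
    _ = (∫ s in (-(1 / 2) : ℝ)..(1 / 2), ∑ j, ∑ l, (p j : ℂ) * p l * anchorIntegrand a (x j) (x l) s)
          - I * anchorTheta a * (anchorSumG a x p (1 / 2) * conj (anchorSumG a x p (1 / 2))) := by
        congr 1
        · rw [intervalIntegral.integral_finsetSum (fun j _ => hrow j)]
          refine Finset.sum_congr rfl fun j _ => ?_
          rw [intervalIntegral.integral_finsetSum (fun l _ => hF j l)]
          refine Finset.sum_congr rfl fun l _ => ?_
          rw [intervalIntegral.integral_const_mul]
        · unfold anchorSumG; rw [sum_sum_mul_conj]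
    _ = _ := by
        congr 1
        exact intervalIntegral.integral_congr fun s _ => (anchorSum_integrand_eq a x p s).symm

/-- `z·conj z = ‖z‖²` as a real cast. [folklore] -/
private theorem mul_conj_eq_norm_sq_cast (z : ℂ) : z * conj z = ((‖z‖ ^ 2 : ℝ) : ℂ) := by
  rw [Complex.mul_conj, Complex.normSq_eq_norm_sq]

/-- The anchor phase lies in `(0, π)` for `a ∈ (0, 2)`. [folklore] -/
private theorem anchorTheta_mem {a : ℝ} (ha : a ∈ Set.Ioo (0 : ℝ) 2) : 0 < anchorTheta a ∧ anchorTheta a < π := by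
  constructor
  · unfold anchorTheta; have := Real.pi_pos; nlinarith [ha.1]
  · unfold anchorTheta; have := Real.pi_pos; nlinarith [ha.2]

/-- **L-B′1 at nodes avoiding the anchor**: for `a ∈ (0,2)` and nodes `x_j ≠ a` (repeats allowed), the real
quadratic form `Σ_j Σ_l p_j p_l·Re m₀(a;x_j,x_l)` equals `π·(sin θ·∫(‖𝒢′‖² − θ²‖𝒢‖²) − θ cos θ·‖𝒢(½)‖²) ≥ 0`.
[cite: Zhang2022LandauSiegel, proof of Prop 7.1, (7.19)–(7.21)] -/
theorem re_ddM0_sum_nonneg_of_ne {a : ℝ} (ha : a ∈ Set.Ioo (0 : ℝ) 2) {n : ℕ} {x : Fin n → ℝ} (p : Fin n → ℝ)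
    (hx : ∀ j, x j ≠ a) : 0 ≤ ∑ j, ∑ l, p j * p l * (ddM0 ![a, x j, x l]).re := by
  obtain ⟨hθ, hθπ⟩ := anchorTheta_mem ha
  -- pass to the real part of the complex double sum
  have hre : ∑ j, ∑ l, p j * p l * (ddM0 ![a, x j, x l]).re = (∑ j, ∑ l, (p j : ℂ) * p l * ddM0 ![a, x j, x l]).re := by
    rw [Complex.re_sum]
    refine Finset.sum_congr rfl fun j _ => ?_
    rw [Complex.re_sum]
    refine Finset.sum_congr rfl fun l _ => ?_
    simp only [Complex.mul_re, Complex.mul_im, Complex.ofReal_re, Complex.ofReal_im, mul_zero, zero_mul, sub_zero,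
      add_zero]
  rw [hre, sum_ddM0_eq p hx]
  -- the integrand and the boundary term are real
  have hint : (∫ s in (-(1 / 2) : ℝ)..(1 / 2), (anchorSumG' a x p s * conj (anchorSumG' a x p s)
        - (anchorTheta a : ℂ) ^ 2 * (anchorSumG a x p s * conj (anchorSumG a x p s)))) =
      ((∫ s in (-(1 / 2) : ℝ)..(1 / 2), (‖anchorSumG' a x p s‖ ^ 2 - anchorTheta a ^ 2 * ‖anchorSumG a x p s‖ ^ 2)
        : ℝ) : ℂ) := by
    rw [← intervalIntegral.integral_ofReal]
    refine intervalIntegral.integral_congr fun s _ => ?_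
    simp only [mul_conj_eq_norm_sq_cast]; push_cast; ring
  rw [hint, mul_conj_eq_norm_sq_cast]
  set A : ℝ := ∫ s in (-(1 / 2) : ℝ)..(1 / 2), (‖anchorSumG' a x p s‖ ^ 2 - anchorTheta a ^ 2 * ‖anchorSumG a x p s‖ ^ 2)
    with hA
  set B : ℝ := ‖anchorSumG a x p (1 / 2)‖ ^ 2 with hB
  -- the ground-state inequality for 𝒢
  have gs := groundState_ineq hθ hθπ (hasDerivAt_anchorSumG p hx) (continuous_anchorSumG' a x p)
    (anchorSumG_neg_half a x p)
  rw [← hA, ← hB] at gs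
  -- compute the real part: Re(−iπ e^{iθ}(A − iθB)) = π (sin θ·A − θ cos θ·B)
  have hexp : cexp (I * anchorTheta a) = (Real.cos (anchorTheta a) : ℂ) + (Real.sin (anchorTheta a) : ℂ) * I := by
    rw [mul_comm, Complex.exp_mul_I, ← Complex.ofReal_cos, ← Complex.ofReal_sin]
  rw [hexp]
  simp only [Complex.mul_re, Complex.mul_im, Complex.sub_re, Complex.sub_im, Complex.add_re, Complex.add_im,
    Complex.neg_re, Complex.neg_im, Complex.I_re, Complex.I_im, Complex.ofReal_re, Complex.ofReal_im]
  ring_nf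
  nlinarith [gs, Real.pi_pos]

/-- The node vector `t ↦ (a, x + t, y + t)` is continuous. [folklore] -/
private theorem continuous_shiftedTriple (a x y : ℝ) : Continuous fun t : ℝ => (![a, x + t, y + t] : Fin 3 → ℝ) := by
  refine continuous_pi fun i => ?_
  fin_cases i
  · exact continuous_const
  · exact continuous_const.add continuous_id
  · exact continuous_const.add continuous_id

/-- **L-B′1 (Re `m₀(a;·,·)` is a positive-semidefinite kernel on the whole real line).** For every `a ∈ (0, 2)` —
in particular every anchor `a ∈ (0, 1]` — every `n`, all real nodes `x : Fin n → ℝ` (repeats and nodes equal to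
the anchor allowed) and all real coefficients `p : Fin n → ℝ`:
`0 ≤ Σ_j Σ_l p_j p_l · Re Det.ddM0 ![a, x_j, x_l]`.
This is the desk conjecture L-B′1 of the cell (ls-Bdet-typer-1, E102-LINEB-PARSEVAL-NOTE §3; two further independent
desk proofs: ls-B-ref-1 LB1-PROOF.md, ls-theory referee PASS 2026-08-27T01:58:50Z / 02:00:36Z), necessary for head 1
of E-102 and sufficient for both heads on the apex-and-mean-vanishing sub-class (T-B′). Nodes equal to the anchor are
reached by continuity of `ddM0` in its nodes (`Det.continuous_ddM0`) along the common shift `x_j ↦ x_j + t`.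
[cite: Zhang2022LandauSiegel, proof of Prop 7.1, (7.19)–(7.21)] -/
theorem re_ddM0_sum_nonneg {a : ℝ} (ha : a ∈ Set.Ioo (0 : ℝ) 2) {n : ℕ} (x p : Fin n → ℝ) :
    0 ≤ ∑ j, ∑ l, p j * p l * (ddM0 ![a, x j, x l]).re := by
  -- the form along the common shift t ↦ x + t is continuous in t
  set Φ : ℝ → ℝ := fun t => ∑ j, ∑ l, p j * p l * (ddM0 ![a, x j + t, x l + t]).re with hΦ
  have hΦc : Continuous Φ := by
    refine continuous_finsetSum _ fun j _ => continuous_finsetSum _ fun l _ => ?_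
    exact continuous_const.mul (Complex.continuous_re.comp (continuous_ddM0.comp (continuous_shiftedTriple a (x j) (x l))))
  -- off the finite set {a − x_j} no shifted node meets the anchor, so Φ ≥ 0 there
  have hbad : (Set.range fun j : Fin n => a - x j).Finite := Set.finite_range _
  have hge : (Set.range fun j : Fin n => a - x j)ᶜ ⊆ {t | 0 ≤ Φ t} := by
    intro t ht
    have hne : ∀ j, x j + t ≠ a := fun j h => ht ⟨j, by linarith⟩
    exact re_ddM0_sum_nonneg_of_ne ha p hne
  have hD : Dense {t | 0 ≤ Φ t} := by
    refine Dense.mono hge ?_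
    rw [Set.compl_eq_univ_sdiff]
    exact dense_univ.sdiff_finite hbad
  have hclosed : IsClosed {t | 0 ≤ Φ t} := isClosed_le continuous_const hΦc
  have h0 : (0 : ℝ) ∈ {t | 0 ≤ Φ t} := by
    rw [← hclosed.closure_eq, hD.closure_eq]; trivial
  simpa [hΦ] using h0

/-- **Complex (Hermitian) form of L-B′1** — the shape consumed by the sub-class Gram series T-B′, whose lattice data
`d(ξ) ∈ ℂⁿ` are complex: for `a ∈ (0,2)`, all real nodes `x` and all `c : Fin n → ℂ`,
`0 ≤ Re Σ_j Σ_l conj(c_j)·c_l·Re m₀(a;x_j,x_l)` (`= Σ` over real and imaginary parts of `c`, the kernel being real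
symmetric). [cite: Zhang2022LandauSiegel, proof of Prop 7.1, (7.19)–(7.21)] -/
theorem re_ddM0_sum_nonneg_complex {a : ℝ} (ha : a ∈ Set.Ioo (0 : ℝ) 2) {n : ℕ} (x : Fin n → ℝ) (c : Fin n → ℂ) :
    0 ≤ (∑ j, ∑ l, conj (c j) * c l * ((ddM0 ![a, x j, x l]).re : ℂ)).re := by
  have h1 := re_ddM0_sum_nonneg ha x (fun j => (c j).re)
  have h2 := re_ddM0_sum_nonneg ha x (fun j => (c j).im)
  have key : (∑ j, ∑ l, conj (c j) * c l * ((ddM0 ![a, x j, x l]).re : ℂ)).re =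
      (∑ j, ∑ l, (c j).re * (c l).re * (ddM0 ![a, x j, x l]).re)
        + ∑ j, ∑ l, (c j).im * (c l).im * (ddM0 ![a, x j, x l]).re := by
    rw [← Finset.sum_add_distrib, Complex.re_sum]
    refine Finset.sum_congr rfl fun j _ => ?_
    rw [← Finset.sum_add_distrib, Complex.re_sum]
    refine Finset.sum_congr rfl fun l _ => ?_
    simp only [Complex.mul_re, Complex.mul_im, Complex.conj_re, Complex.conj_im, Complex.ofReal_re,
      Complex.ofReal_im]
    ring
  rw [key]
  exact add_nonneg h1 h2

/-! ### Part 5 (v2 append) — the NULL NODE: the row `x = 0` of the kernel vanishes, `Re m₀(a; 0, y) = 0`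
(REF-B1 rider (n2) 2026-08-27T01:59:25Z: the kernel's degenerate direction = the palette point `0`, cf. `ker H_a = ℂ·e^{−iπas}`). -/

/-- The node pair `p = (a, y) ↦ (a, 0, y)` is continuous. [folklore] -/
private theorem continuous_zeroNodeTriple : Continuous fun p : ℝ × ℝ => (![p.1, 0, p.2] : Fin 3 → ℝ) := by
  refine continuous_pi fun i => ?_
  fin_cases i
  · exact continuous_fst
  · exact continuous_const
  · exact continuous_snd

/-- Generic nodes: `m₀(a;0,y) = (e^{−iw} − e^{iw})/(y − a)`, `w = π(y−a)/2` — purely imaginary.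
[cite: Zhang2022LandauSiegel, proof of Prop 7.1, (7.19)–(7.21)] -/
private theorem ddM0_zero_node_of_ne {a y : ℝ} (ha : a ≠ 0) (hy : y ≠ 0) (hay : a ≠ y) :
    ddM0 ![a, 0, y] = (cexp (-(((π * (y - a) / 2 : ℝ) : ℂ) * I)) - cexp (((π * (y - a) / 2 : ℝ) : ℂ) * I))
      / ((y - a : ℝ) : ℂ) := by
  have h0y : (0 : ℝ) ≠ y := fun h => hy h.symm
  have lhs : ddM0 ![a, 0, y] =
      a * cexp (I * π * (((a + 0 + y) / 2 - a : ℝ) : ℂ)) / (((0 - a) * (y - a) : ℝ) : ℂ)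
        + (0 : ℝ) * cexp (I * π * (((a + 0 + y) / 2 - 0 : ℝ) : ℂ)) / (((a - 0) * (y - 0) : ℝ) : ℂ)
        + y * cexp (I * π * (((a + 0 + y) / 2 - y : ℝ) : ℂ)) / (((a - y) * (0 - y) : ℝ) : ℂ) := by
    simp only [ddM0, ddOf, shiftB, Matrix.cons_val_zero, Matrix.cons_val_one, Matrix.cons_val_two, Matrix.head_cons,
      Matrix.tail_cons]
    rw [dd2_of_ne _ _ _ ha h0y hay]
    simp only [ddBase, pow_one, Complex.ofReal_zero]
  have e1 : cexp (I * π * (((a + 0 + y) / 2 - a : ℝ) : ℂ)) = cexp (((π * (y - a) / 2 : ℝ) : ℂ) * I) := by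
    congr 1; push_cast; ring
  have e2 : cexp (I * π * (((a + 0 + y) / 2 - y : ℝ) : ℂ)) = cexp (-(((π * (y - a) / 2 : ℝ) : ℂ) * I)) := by
    congr 1; push_cast; ring
  have hac : (a : ℂ) ≠ 0 := by exact_mod_cast ha
  have hyc : (y : ℂ) ≠ 0 := by exact_mod_cast hy
  have hya : (y : ℂ) - a ≠ 0 := by exact_mod_cast sub_ne_zero.mpr (Ne.symm hay)
  have hay' : (a : ℂ) - y ≠ 0 := by exact_mod_cast sub_ne_zero.mpr hay
  rw [lhs, e1, e2]
  push_cast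
  field_simp
  ring

/-- **The null node (`@[simp]`-grade): `Re m₀(a; 0, y) = Re Det.ddM0 ![a, 0, y] = 0` for ALL real `a, y`** (generic nodes
by the residue formula — the value is `(e^{−iw} − e^{iw})/(y−a)`, purely imaginary — and the degenerate ones `a = 0`,
`y = 0`, `y = a` by continuity of `ddM0` along the dense set of generic node pairs). The palette point `0` is the
kernel's degenerate direction (`K_a(0,·) ≡ 0`). [cite: Zhang2022LandauSiegel, proof of Prop 7.1, (7.19)–(7.21)] -/
@[simp] theorem re_ddM0_zero_node (a y : ℝ) : (ddM0 ![a, 0, y]).re = 0 := by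
  have hf : Continuous fun p : ℝ × ℝ => (ddM0 ![p.1, 0, p.2]).re :=
    Complex.continuous_re.comp (continuous_ddM0.comp continuous_zeroNodeTriple)
  have hg : Continuous fun _ : ℝ × ℝ => (0 : ℝ) := continuous_const
  have key := eq_of_eqOn_pairwise_ne (0 : ℝ) hf hg fun a' y' h0a hay h0y => by
    show (ddM0 ![a', 0, y']).re = 0
    rw [ddM0_zero_node_of_ne (Ne.symm h0a) (Ne.symm h0y) hay, Complex.div_ofReal_re, Complex.sub_re,
      show -(((π * (y' - a') / 2 : ℝ) : ℂ) * I) = (((-(π * (y' - a') / 2) : ℝ)) : ℂ) * I by push_cast; ring,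
      Complex.exp_ofReal_mul_I_re, Complex.exp_ofReal_mul_I_re, Real.cos_neg, sub_self, zero_div]
  exact congrFun key (a, y)

/-- The null node in the second palette slot: `Re m₀(a; x, 0) = 0`.
[cite: Zhang2022LandauSiegel, proof of Prop 7.1, (7.19)–(7.21)] -/
@[simp] theorem re_ddM0_zero_node' (a x : ℝ) : (ddM0 ![a, x, 0]).re = 0 := by
  rw [ddM0_swap a 0 x]; exact re_ddM0_zero_node a x

/-! ### Part 6 (v3 append) — L-B′1 packaged as `Matrix.PosSemidef` (the shape consumed under integrals by the
E-102 head-1 sum-of-squares leaf: `R := [Re m₀(a;b_j,b_l)]` is a real symmetric positive-semidefinite matrix) -/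

/-- **The anchor kernel matrix `R(a;x) := [Re Det.ddM0 ![a, x_j, x_l]]_{j,l}` is positive-semidefinite** (`Matrix.PosSemidef`
over `ℝ`) for every `a ∈ (0,2)` and every real node vector `x` (repeats and nodes equal to the anchor allowed): symmetric by
`Det.ddM0_swap`, non-negative quadratic form by `Det.re_ddM0_sum_nonneg`. [cite: Zhang2022LandauSiegel, proof of Prop 7.1, (7.19)–(7.21)] -/
theorem posSemidef_re_ddM0 {a : ℝ} (ha : a ∈ Set.Ioo (0 : ℝ) 2) {n : ℕ} (x : Fin n → ℝ) :
    (Matrix.of fun j l : Fin n => (ddM0 ![a, x j, x l]).re).PosSemidef := by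
  refine Matrix.PosSemidef.of_dotProduct_mulVec_nonneg ?_ fun v => ?_
  · ext j l
    simp only [Matrix.conjTranspose_apply, Matrix.of_apply, star_trivial]
    rw [ddM0_swap a (x j) (x l)]
  · have h := re_ddM0_sum_nonneg ha x v
    have e : dotProduct (star v) ((Matrix.of fun j l : Fin n => (ddM0 ![a, x j, x l]).re).mulVec v)
        = ∑ j, ∑ l, v j * v l * (ddM0 ![a, x j, x l]).re := by
      simp only [dotProduct, Matrix.mulVec, Matrix.of_apply, star_trivial, Finset.mul_sum]
      refine Finset.sum_congr rfl fun j _ => Finset.sum_congr rfl fun l _ => ?_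
      ring
    rw [e]; exact h

/-- The `R`-weighted square of a complex vector is non-negative: `0 ≤ Σ_{j,l} R_{jl}·v_l·conj v_j` (as a real part; the sum
is real by symmetry) — the pointwise integrand of `∫‖w′ + θ tan(θy) w‖²_R` in the head-1 sum of squares.
[cite: Zhang2022LandauSiegel, proof of Prop 7.1, (7.19)–(7.21)] -/
theorem re_ddM0_quadForm_nonneg {a : ℝ} (ha : a ∈ Set.Ioo (0 : ℝ) 2) {n : ℕ} (x : Fin n → ℝ) (v : Fin n → ℂ) :
    0 ≤ (∑ j, ∑ l, ((ddM0 ![a, x j, x l]).re : ℂ) * (v l * conj (v j))).re := by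
  have h := re_ddM0_sum_nonneg_complex ha x v
  have e : (∑ j, ∑ l, ((ddM0 ![a, x j, x l]).re : ℂ) * (v l * conj (v j)))
      = ∑ j, ∑ l, conj (v j) * v l * ((ddM0 ![a, x j, x l]).re : ℂ) := by
    refine Finset.sum_congr rfl fun j _ => Finset.sum_congr rfl fun l _ => ?_
    ring
  rw [e]; exact h

end Det

end Literature.NumberTheory.LFunctions.Zhang2022
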